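import Summits.CriticalPhenomena.SAWScalingLimit.Theorems.SAWLeftRightFKGFKGToTraversalBoundSlitNecklaceOutline
import Literature.Probability.LatticeModels.SquareTilingCrosscut
import HarnessLib

/-!
# Vocabulary of line `slit-necklace`, part 6: the wall-follower tour as a walk of FACES

Crux `SAWLeftRightFKG.FKGToTraversalBound` (stmt-CriticalPhenomena-1878), line `slit-necklace`, lead
prover-line-stmt-CriticalPhenomena-1878-c5-0; witness units U2 (`abab`-freeness of hugging runs) and U4 (child side
of a far-tip piece).

The planar lemmas of the witness are proved with the tree's COMBINATORIAL winding number
`Literature.Probability.Percolation.walkWinding p z` of a closed lattice walk `p` about the unit face with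
lower-left corner `z` (`PlanarDuality.lean`: constancy along face walks not crossing an edge of `p`,
`walkWinding_eq_of_faceWalk`; constancy along site walks avoiding `p`, `walkWinding_eq_of_walk_closed`; equality
of the four faces around a site off `p`, `walkWinding_eq_of_mem_corners`; jump `±1` across an edge used once,
`walkWinding_sub_eq_of_vertical_mem` / `…horizontal_mem`).  The corners visited by the wall-follower tour of a
site set `A` (`…SlitNecklaceOutline`: `bnext`, `btour`) are face centres; this file names the face of the START
corner of a boundary edge, `cornerFace (x, d) = x + foff d`, and records that one step of the tour is ONE FACE
STEP across the primal edge `{x, x + d}` of the current boundary edge (`cornerFace_bnext`,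
`sepEdge_cornerFace`): a tour arc is a face walk crossing exactly the primal edges of its own positions.  The two
faces of the dual segment of `(x, d)` are faces around the outline site `x` and around the contact site `x + d`
(`cornerFace_add_one_mem_corners`, `cornerFace_add_one_mem_corners_contact`, and the `end` versions), in the
indexing of `walkWinding_eq_of_mem_corners` (face `f` is around site `q` iff `f + 1 ∈ corners q`).

Definitions and closed lemmas only (coordinate computations); no literature fact; nothing restates the crux.
[folklore: boundary tracing of a polyomino on the dual lattice]
-/

noncomputable section

open Literature.Probability.LatticeModels Literature.Probability.Percolation
open Literature.Probability.LatticeModels.SquareTiling (corners mem_corners_iff)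

namespace Summit.CriticalPhenomena.SAWScalingLimit.Theorems.FKGToTraversalBound.SlitNecklace

namespace ODir

/-- Offset from the outline site `x` to the lower-left corner of the face of the START corner of the boundary
edge `(x, d)`: `E ↦ (0,-1)`, `N ↦ (0,0)`, `W ↦ (-1,0)`, `S ↦ (-1,-1)`. [folklore] -/
def foff : ODir → Site 2
  | 0 => -Pi.single 1 1
  | 1 => 0
  | 2 => -Pi.single 0 1
  | 3 => -Pi.single 0 1 - Pi.single 1 1

/-- Turning left: the start-corner face of `(x, ccw d)` is that of `(x, d)` moved by `vec (ccw d)`. [folklore] -/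
theorem foff_ccw (d : ODir) : d.ccw.foff = d.foff + d.ccw.vec := by
  ext i; fin_cases d <;> fin_cases i <;> simp [foff, ccw, vec]

/-- Turning right: `vec d + vec (ccw d) + foff (cw d) = foff d + vec (ccw d)`. [folklore] -/
theorem foff_cw (d : ODir) : d.vec + d.ccw.vec + d.cw.foff = d.foff + d.ccw.vec := by
  ext i; fin_cases d <;> fin_cases i <;> simp [foff, ccw, cw, vec]

end ODir

/-- The FACE of the start corner of the boundary edge `e = (x, d)`, named by its lower-left corner (the convention
of `walkWinding`): its centre is the start corner `x + (vec d + vec (cw d)) / 2` of the dual segment of `e`.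
[folklore] -/
def cornerFace (e : Site 2 × ODir) : Site 2 := e.1 + e.2.foff

/-- `cornerFace` unfolded. [folklore] -/
@[simp] theorem cornerFace_mk (x : Site 2) (d : ODir) : cornerFace (x, d) = x + d.foff := rfl

/-- **One step of the wall follower is one face step in the travel direction**: the start-corner face of
`bnext A (x, d)` is the start-corner face of `(x, d)` moved by `vec (ccw d)` (the face of the END corner of
`(x, d)`). [folklore] -/
theorem cornerFace_bnext (A : Set (Site 2)) (x : Site 2) (d : ODir) :
    cornerFace (bnext A (x, d)) = cornerFace (x, d) + d.ccw.vec := by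
  rcases bnext_cases A x d with ⟨-, h⟩ | ⟨-, -, h⟩ | ⟨-, -, h⟩ <;> rw [h] <;> simp only [cornerFace_mk]
  · rw [ODir.foff_ccw, add_assoc]
  · abel
  · rw [add_assoc x, add_assoc x, ODir.foff_cw, add_assoc]

/-- **Registered glue**: along the tour, consecutive start-corner faces differ by the unit vector of the travel
direction (the tour is a face walk). [folklore] -/
theorem cornerFace_btour_succ : ∀ (A : Set (Site 2)) (e₀ : Site 2 × ODir) (n : ℕ), cornerFace (btour A e₀ (n + 1)) = cornerFace (btour A e₀ n) + (btour A e₀ n).2.ccw.vec := by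
  intro A e₀ n
  rw [btour_succ]
  obtain ⟨x, d⟩ := btour A e₀ n
  exact cornerFace_bnext A x d

/-- Consecutive tour faces are lattice-adjacent. [folklore] -/
theorem adj_cornerFace_add (e : Site 2 × ODir) : (zdGraph 2).Adj (cornerFace e) (cornerFace e + e.2.ccw.vec) :=
  ODir.adj_add_vec _ _

/-- The face step of an EAST boundary edge crosses `{x, x + e₀}`. [folklore] -/
private theorem sepEdge_cornerFace_E (x : Site 2) :
    sepEdge (cornerFace (x, (0 : ODir))) (cornerFace (x, (0 : ODir)) + ODir.vec (ODir.ccw 0)) =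
      s(x, x + ODir.vec 0) := by
  have h1 : cornerFace (x, (0 : ODir)) = x - Pi.single 1 1 := by
    simp [ODir.foff, sub_eq_add_neg]
  have h2 : ODir.vec (ODir.ccw 0) = Pi.single 1 1 := by simp [ODir.ccw, ODir.vec]
  have h3 : ODir.vec (0 : ODir) = Pi.single 0 1 := by simp [ODir.vec]
  rw [h1, h2, h3, sepEdge_up, sub_add_cancel]

/-- The face step of a NORTH boundary edge crosses `{x, x + e₁}`. [folklore] -/
private theorem sepEdge_cornerFace_N (x : Site 2) :
    sepEdge (cornerFace (x, (1 : ODir))) (cornerFace (x, (1 : ODir)) + ODir.vec (ODir.ccw 1)) =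
      s(x, x + ODir.vec 1) := by
  have h1 : cornerFace (x, (1 : ODir)) = x := by simp [ODir.foff]
  have h2 : x + ODir.vec (ODir.ccw 1) = x - Pi.single 0 1 := by
    simp [ODir.ccw, ODir.vec, sub_eq_add_neg]
  have h3 : ODir.vec (1 : ODir) = Pi.single 1 1 := by simp [ODir.vec]
  rw [h1, h2, h3, sepEdge_comm]
  have h4 : x = (x - Pi.single 0 1) + Pi.single 0 1 := by abel
  conv_lhs => rw [h4, add_sub_cancel_right]
  rw [sepEdge_right, sub_add_cancel]

/-- The face step of a WEST boundary edge crosses `{x - e₀, x}`. [folklore] -/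
private theorem sepEdge_cornerFace_W (x : Site 2) :
    sepEdge (cornerFace (x, (2 : ODir))) (cornerFace (x, (2 : ODir)) + ODir.vec (ODir.ccw 2)) =
      s(x, x + ODir.vec 2) := by
  have h1 : cornerFace (x, (2 : ODir)) = x - Pi.single 0 1 := by
    simp [ODir.foff, sub_eq_add_neg]
  have h2 : x - Pi.single 0 1 + ODir.vec (ODir.ccw 2) = (x - Pi.single 0 1) - Pi.single 1 1 := by
    simp [ODir.ccw, ODir.vec, sub_eq_add_neg]
  have h3 : x + ODir.vec (2 : ODir) = x - Pi.single 0 1 := by simp [ODir.vec, sub_eq_add_neg]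
  rw [h1, h2, h3, sepEdge_comm]
  have h4 : x - Pi.single 0 1 = (x - Pi.single 0 1 - Pi.single 1 1) + Pi.single 1 1 := by abel
  conv_lhs => rw [h4, add_sub_cancel_right]
  rw [sepEdge_up, Sym2.eq_swap]
  congr 1 <;> abel

/-- The face step of a SOUTH boundary edge crosses `{x - e₁, x}`. [folklore] -/
private theorem sepEdge_cornerFace_S (x : Site 2) :
    sepEdge (cornerFace (x, (3 : ODir))) (cornerFace (x, (3 : ODir)) + ODir.vec (ODir.ccw 3)) =
      s(x, x + ODir.vec 3) := by
  have h1 : cornerFace (x, (3 : ODir)) = x - Pi.single 0 1 - Pi.single 1 1 := by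
    simp [ODir.foff, sub_eq_add_neg]; abel
  have h2 : ODir.vec (ODir.ccw 3) = Pi.single 0 1 := by simp [ODir.ccw, ODir.vec]
  have h3 : x + ODir.vec (3 : ODir) = x - Pi.single 1 1 := by simp [ODir.vec, sub_eq_add_neg]
  rw [h1, h2, h3, sepEdge_right, Sym2.eq_swap]
  congr 1 <;> abel

/-- **The face step of the boundary edge `(x, d)` crosses its primal edge**: the primal edge separating the
start-corner face of `(x, d)` from its end-corner face is `{x, x + vec d}`. [folklore] -/
theorem sepEdge_cornerFace (x : Site 2) (d : ODir) :
    sepEdge (cornerFace (x, d)) (cornerFace (x, d) + d.ccw.vec) = s(x, x + d.vec) := by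
  fin_cases d
  exacts [sepEdge_cornerFace_E x, sepEdge_cornerFace_N x, sepEdge_cornerFace_W x, sepEdge_cornerFace_S x]

/-- The start-corner face of `(x, d)` is one of the four faces around the outline site `x`
(`f + 1 ∈ corners x`, the indexing of `walkWinding_eq_of_mem_corners`). [folklore] -/
theorem cornerFace_add_one_mem_corners (x : Site 2) (d : ODir) : cornerFace (x, d) + 1 ∈ corners x := by
  rw [mem_corners_iff]
  fin_cases d <;> simp [ODir.foff]

/-- The start-corner face of `(x, d)` is one of the four faces around the contact site `x + vec d`. [folklore] -/
theorem cornerFace_add_one_mem_corners_contact (x : Site 2) (d : ODir) :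
    cornerFace (x, d) + 1 ∈ corners (x + d.vec) := by
  rw [mem_corners_iff]
  fin_cases d <;> simp [ODir.foff, ODir.vec]

/-- The end-corner face of `(x, d)` is one of the four faces around the outline site `x`. [folklore] -/
theorem cornerFace_end_add_one_mem_corners (x : Site 2) (d : ODir) :
    cornerFace (x, d) + d.ccw.vec + 1 ∈ corners x := by
  rw [mem_corners_iff]
  fin_cases d <;> simp [ODir.foff, ODir.vec, ODir.ccw]

/-- The end-corner face of `(x, d)` is one of the four faces around the contact site `x + vec d`. [folklore] -/
theorem cornerFace_end_add_one_mem_corners_contact (x : Site 2) (d : ODir) :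
    cornerFace (x, d) + d.ccw.vec + 1 ∈ corners (x + d.vec) := by
  rw [mem_corners_iff]
  fin_cases d <;> simp [ODir.foff, ODir.vec, ODir.ccw]

end Summit.CriticalPhenomena.SAWScalingLimit.Theorems.FKGToTraversalBound.SlitNecklace

end
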